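import Literature.NumberTheory.Automorphic.HeisenbergStrataMeasure      -- ★ L-α2b FILE B (this seat): `measureReal_rankStratum_two ∕ _one ∕ _zero`, §1 topology of the balls; closure: ★ FILE A
import HarnessLib

/-!
# The integral of a residual-rank piece over `N` at a non-split place: `∫_N F dμ_N = μ_N(N ∩ K₃) · q⁻³ · (c₀ + c₁(q − 1) + c₂(q³ − q))`

Topic `NumberTheory/Automorphic`; namespace `Literature.NumberTheory.Automorphic.UnitaryGroup`.  KERNEL MATHEMATICS ONLY: theorems, no definition,
no named fact, no `sorry`, no instance, no notation.  Cell `pub/hodgecm-mathlib`, road «S3-tree», T3′ «DEPTH-ZERO κ-TRANSFER» (HEAD v4 clause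
`depthZeroKappaTransfer_hyperspecial_levi`, population P-3 «LEVI»), organ **L-α2b FILE C «HEISENBERG STRATA INTEGRAL»** (seat F0P3a-p04 (g16)), sequel of ★
`HeisenbergChartAtNonsplitPlace` (FILE A) and ★ `HeisenbergStrataMeasure` (FILE B).  HONEST LABEL: HC_CM is proved only modulo the 2 remaining named inputs
(hLiu418 24832, h413 24833) until rung 0 closes; this file discharges nothing.

THE MATHEMATICS ([Rogawski1990] §4.9 p. 54; [Flicker1998UnitaryFL] §2).  Setting of FILE B (`L` CM, `v` non-split unramified, `v ∤ 2`, `N = unipotentU (c ⊗ 1) Φ₃`,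
`K₃ = U(Φ₃)(𝒪_v)`, `q = N𝔭_v`).  A DEPTH-ZERO PIECE restricted to `N` is a function `F : N → ℂ` with `F(n) = c(rank(red(n_w) − 1))` for `n ∈ N ∩ K₃` and
`F(n) = 0` otherwise (HEAD v4's binders `hgK`, `hc` read on `N`).  Then
**`∫_N F dμ_N = c₀·μ_N(S₀) + c₁·μ_N(S₁) + c₂·μ_N(S₂) = μ_N(N ∩ K₃) · q⁻³ · (c₀·1 + c₁·(q − 1) + c₂·(q³ − q))`** for EVERY Haar measure `μ_N` of `N`
(`integral_eq_of_eq_piece_rank`) — `μ_N(N ∩ K₃)` times the left side of ★ `Flicker1998.depthZero_matrix_identity_levi`.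
* §1 `N ∩ K₃` is COMPACT and the strata `S_r` are Borel (images of products of balls∕shells under the chart homeomorphism ★ `heisHomeomorph`);
  on `N ∩ K₃` the rank is `0`, `1` or `2` (`rank_redMat_sub_one_cases_of_mem`).
* §2 the integral (`integral_eq_of_eq_piece_rank`).

## References
* [Rogawski1990] J. D. Rogawski, *Automorphic Representations of Unitary Groups in Three Variables*, Ann. of Math. Stud. 123 (1990), §1.10 p. 9; §4.9 p. 54.
* [Flicker1998UnitaryFL] Y. Z. Flicker, *Elementary proof of the fundamental lemma for a unitary group*, Canad. J. Math. 50 (1998), §2.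
* [GetzHahn2024] J. Getz, H. Hahn, *An Introduction to Automorphic Representations*, GTM 300 (2024), §3.5 Example 3.1 (Haar measures in coordinates).
-/

set_option autoImplicit false

noncomputable section

open IsDedekindDomain NumberField Matrix MeasureTheory Measure Topology
open scoped NumberField MatrixGroups Matrix NNReal ENNReal

namespace Literature.NumberTheory.Automorphic.UnitaryGroup

open Literature.NumberTheory.Automorphic Literature.NumberTheory.Automorphic.IntegralReduction

variable (L : Type) [Field L] [NumberField L] [IsCMField L] (v : HeightOneSpectrum (𝓞 ↥(maximalRealSubfield L)))
  (w : PlacesOver L v) (hw : IsCMField.complexConj L • w.1 = w.1)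

/-! ## §1 Compactness of `N ∩ K₃`, measurability of the strata, the rank trichotomy on `N ∩ K₃` -/

/-- The balls and the unit sphere of `R` and of `R⁻` at `w` are Borel sets. [cite: Rogawski1990, §1.10 p. 9] -/
private theorem measurableSet_balls [MeasurableSpace (LocalRing L v)] [BorelSpace (LocalRing L v)] :
    MeasurableSet {x : LocalRing L v | Valued.v (x w) ≤ 1} ∧ MeasurableSet {x : LocalRing L v | Valued.v (x w) < 1} ∧
      MeasurableSet {x : LocalRing L v | Valued.v (x w) = 1} ∧
      MeasurableSet {y : ↥(HeisRing.skewPart (conjLocal L (IsCMField.complexConj L) v)) | Valued.v ((y : LocalRing L v) w) ≤ 1} ∧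
      MeasurableSet {y : ↥(HeisRing.skewPart (conjLocal L (IsCMField.complexConj L) v)) | Valued.v ((y : LocalRing L v) w) < 1} ∧
      MeasurableSet {y : ↥(HeisRing.skewPart (conjLocal L (IsCMField.complexConj L) v)) | Valued.v ((y : LocalRing L v) w) = 1} := by
  have h1 : MeasurableSet {x : LocalRing L v | Valued.v (x w) ≤ 1} := (isClosed_setOf_valued_apply_le_one L v w).measurableSet
  have h2 : MeasurableSet {x : LocalRing L v | Valued.v (x w) < 1} := (isOpen_setOf_valued_apply_lt_one L v w).measurableSet
  have h3 : {x : LocalRing L v | Valued.v (x w) = 1} = {x : LocalRing L v | Valued.v (x w) ≤ 1} \ {x : LocalRing L v | Valued.v (x w) < 1} := by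
    ext x
    simp only [Set.mem_setOf_eq, Set.mem_sdiff, not_lt]
    exact ⟨fun h => ⟨h.le, h.ge⟩, fun h => le_antisymm h.1 h.2⟩
  have h4 : MeasurableSet {y : ↥(HeisRing.skewPart (conjLocal L (IsCMField.complexConj L) v)) | Valued.v ((y : LocalRing L v) w) ≤ 1} :=
    measurable_subtype_coe h1
  have h5 : MeasurableSet {y : ↥(HeisRing.skewPart (conjLocal L (IsCMField.complexConj L) v)) | Valued.v ((y : LocalRing L v) w) < 1} :=
    measurable_subtype_coe h2
  have h6 : {y : ↥(HeisRing.skewPart (conjLocal L (IsCMField.complexConj L) v)) | Valued.v ((y : LocalRing L v) w) = 1} =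
      {y : ↥(HeisRing.skewPart (conjLocal L (IsCMField.complexConj L) v)) | Valued.v ((y : LocalRing L v) w) ≤ 1} \
        {y : ↥(HeisRing.skewPart (conjLocal L (IsCMField.complexConj L) v)) | Valued.v ((y : LocalRing L v) w) < 1} := by
    ext y
    simp only [Set.mem_setOf_eq, Set.mem_sdiff, not_lt]
    exact ⟨fun h => ⟨h.le, h.ge⟩, fun h => le_antisymm h.1 h.2⟩
  exact ⟨h1, h2, h3 ▸ h1.diff h2, h4, h5, h6 ▸ h4.diff h5⟩

include hw in
/-- **`N ∩ K₃` IS COMPACT**: it is the image of the compact `𝒪 × 𝒪⁻` under the chart (★ FILE A `preimage_heisHomeomorph_setOf_mem`, ★ FILE B `isCompact_setOf_valued_apply_le_one`).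
[cite: Rogawski1990, §1.10 p. 9; §4.9 p. 54] -/
theorem isCompact_setOf_mem_level (h2w : Valued.v (2 : w.1.adicCompletion L) = 1) :
    IsCompact {n : ↥(unipotentU (conjLocal L (IsCMField.complexConj L) v) (cmLocalForm L 3 v)) | (n : ↥(unitaryGroupOfForm (conjLocal L (IsCMField.complexConj L) v) (cmLocalForm L 3 v))) ∈ cmLocalIntegralLevel L 3 (Matrix.of fun i j : Fin 3 => if i.val + j.val + 1 = 3 then (1 : L) else 0) v} := by
  letI : Invertible (2 : LocalRing L v) := (isUnit_two_localRing L v).invertible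
  have hAc : IsCompact {x : LocalRing L v | Valued.v (x w) ≤ 1} := isCompact_setOf_valued_apply_le_one L v w hw
  have hBc : IsCompact {y : ↥(HeisRing.skewPart (conjLocal L (IsCMField.complexConj L) v)) | Valued.v ((y : LocalRing L v) w) ≤ 1} :=
    (HeisRing.isClosed_skewPart (conjLocal L (IsCMField.complexConj L) v) (continuous_conjLocal L (IsCMField.complexConj L) v)).isClosedEmbedding_subtypeVal.isCompact_preimage hAc
  rw [← (HeisRing.heisHomeomorph (conjLocal L (IsCMField.complexConj L) v) (conjLocal_conjLocal_cm L v) (continuous_conjLocal L (IsCMField.complexConj L) v)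
        (cmLocalForm_eq_over L 3 v)).image_preimage
    {n : ↥(unipotentU (conjLocal L (IsCMField.complexConj L) v) (cmLocalForm L 3 v)) | (n : ↥(unitaryGroupOfForm (conjLocal L (IsCMField.complexConj L) v) (cmLocalForm L 3 v))) ∈ cmLocalIntegralLevel L 3 (Matrix.of fun i j : Fin 3 => if i.val + j.val + 1 = 3 then (1 : L) else 0) v},
    preimage_heisHomeomorph_setOf_mem L v w hw h2w]
  exact (hAc.prod hBc).image
    (HeisRing.heisHomeomorph (conjLocal L (IsCMField.complexConj L) v) (conjLocal_conjLocal_cm L v) (continuous_conjLocal L (IsCMField.complexConj L) v)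
        (cmLocalForm_eq_over L 3 v)).continuous

include hw in
/-- **THE STRATA ARE BOREL**: `N ∩ K₃` and `S₂, S₁, S₀` are images of Borel products under the chart homeomorphism. [cite: Rogawski1990, §4.9 p. 54] -/
theorem measurableSet_level_and_rankStrata [MeasurableSpace ↥(unipotentU (conjLocal L (IsCMField.complexConj L) v) (cmLocalForm L 3 v))] [BorelSpace ↥(unipotentU (conjLocal L (IsCMField.complexConj L) v) (cmLocalForm L 3 v))] (h2w : Valued.v (2 : w.1.adicCompletion L) = 1) :
    MeasurableSet {n : ↥(unipotentU (conjLocal L (IsCMField.complexConj L) v) (cmLocalForm L 3 v)) | (n : ↥(unitaryGroupOfForm (conjLocal L (IsCMField.complexConj L) v) (cmLocalForm L 3 v))) ∈ cmLocalIntegralLevel L 3 (Matrix.of fun i j : Fin 3 => if i.val + j.val + 1 = 3 then (1 : L) else 0) v} ∧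
      MeasurableSet {n : ↥(unipotentU (conjLocal L (IsCMField.complexConj L) v) (cmLocalForm L 3 v)) | (n : ↥(unitaryGroupOfForm (conjLocal L (IsCMField.complexConj L) v) (cmLocalForm L 3 v))) ∈
          cmLocalIntegralLevel L 3 (Matrix.of fun i j : Fin 3 => if i.val + j.val + 1 = 3 then (1 : L) else 0) v ∧
        (redMat (((n : ↥(unitaryGroupOfForm (conjLocal L (IsCMField.complexConj L) v) (cmLocalForm L 3 v))) : GL (Fin 3) (LocalRing L v)).val.map (Pi.evalRingHom (fun w' : PlacesOver L v => w'.1.adicCompletion L) w)) - 1).rank = 2} ∧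
      MeasurableSet {n : ↥(unipotentU (conjLocal L (IsCMField.complexConj L) v) (cmLocalForm L 3 v)) | (n : ↥(unitaryGroupOfForm (conjLocal L (IsCMField.complexConj L) v) (cmLocalForm L 3 v))) ∈
          cmLocalIntegralLevel L 3 (Matrix.of fun i j : Fin 3 => if i.val + j.val + 1 = 3 then (1 : L) else 0) v ∧
        (redMat (((n : ↥(unitaryGroupOfForm (conjLocal L (IsCMField.complexConj L) v) (cmLocalForm L 3 v))) : GL (Fin 3) (LocalRing L v)).val.map (Pi.evalRingHom (fun w' : PlacesOver L v => w'.1.adicCompletion L) w)) - 1).rank = 1} ∧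
      MeasurableSet {n : ↥(unipotentU (conjLocal L (IsCMField.complexConj L) v) (cmLocalForm L 3 v)) | (n : ↥(unitaryGroupOfForm (conjLocal L (IsCMField.complexConj L) v) (cmLocalForm L 3 v))) ∈
          cmLocalIntegralLevel L 3 (Matrix.of fun i j : Fin 3 => if i.val + j.val + 1 = 3 then (1 : L) else 0) v ∧
        (redMat (((n : ↥(unitaryGroupOfForm (conjLocal L (IsCMField.complexConj L) v) (cmLocalForm L 3 v))) : GL (Fin 3) (LocalRing L v)).val.map (Pi.evalRingHom (fun w' : PlacesOver L v => w'.1.adicCompletion L) w)) - 1).rank = 0} := by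
  haveI : SecondCountableTopology (LocalRing L v) := secondCountableTopology_localRing (E := L) v
  letI : MeasurableSpace (LocalRing L v) := borel _
  haveI : BorelSpace (LocalRing L v) := ⟨rfl⟩
  letI : Invertible (2 : LocalRing L v) := (isUnit_two_localRing L v).invertible
  haveI : SecondCountableTopology ↥(HeisRing.skewPart (conjLocal L (IsCMField.complexConj L) v)) := TopologicalSpace.Subtype.secondCountableTopology _
  obtain ⟨hA, hA', hAs, hB, hB', hBs⟩ := measurableSet_balls L v w
  have himg : ∀ (S : Set ↥(unipotentU (conjLocal L (IsCMField.complexConj L) v) (cmLocalForm L 3 v))) (A' : Set (LocalRing L v)) (B' : Set ↥(HeisRing.skewPart (conjLocal L (IsCMField.complexConj L) v))),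
      (HeisRing.heisHomeomorph (conjLocal L (IsCMField.complexConj L) v) (conjLocal_conjLocal_cm L v) (continuous_conjLocal L (IsCMField.complexConj L) v)
        (cmLocalForm_eq_over L 3 v)) ⁻¹' S = A' ×ˢ B' → MeasurableSet A' → MeasurableSet B' → MeasurableSet S := by
    intro S A' B' hS hA' hB'
    rw [← (HeisRing.heisHomeomorph (conjLocal L (IsCMField.complexConj L) v) (conjLocal_conjLocal_cm L v) (continuous_conjLocal L (IsCMField.complexConj L) v)
        (cmLocalForm_eq_over L 3 v)).image_preimage S, hS]
    exact (HeisRing.heisHomeomorph (conjLocal L (IsCMField.complexConj L) v) (conjLocal_conjLocal_cm L v) (continuous_conjLocal L (IsCMField.complexConj L) v)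
        (cmLocalForm_eq_over L 3 v)).toMeasurableEquiv.measurableSet_image.2 (hA'.prod hB')
  exact ⟨himg _ _ _ (preimage_heisHomeomorph_setOf_mem L v w hw h2w) hA hB,
    himg _ _ _ (preimage_heisHomeomorph_rankStratum_two L v w hw h2w) hAs hB,
    himg _ _ _ (preimage_heisHomeomorph_rankStratum_one L v w hw h2w) hA' hBs,
    himg _ _ _ (preimage_heisHomeomorph_rankStratum_zero L v w hw h2w) hA' hB'⟩

include hw in
/-- **ON `N ∩ K₃` THE RESIDUAL RANK IS `0`, `1` OR `2`** (read in the chart `n = u(x, z)`, `|x_w|, |y_w| ≤ 1`, by the trichotomy of ★ FILE A).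
[cite: Rogawski1990, §4.9 p. 54] [cite: Flicker1998UnitaryFL, §2] -/
theorem rank_redMat_sub_one_cases_of_mem (h2w : Valued.v (2 : w.1.adicCompletion L) = 1) {n : ↥(unipotentU (conjLocal L (IsCMField.complexConj L) v) (cmLocalForm L 3 v))}
    (hn : (n : ↥(unitaryGroupOfForm (conjLocal L (IsCMField.complexConj L) v) (cmLocalForm L 3 v))) ∈ cmLocalIntegralLevel L 3 (Matrix.of fun i j : Fin 3 => if i.val + j.val + 1 = 3 then (1 : L) else 0) v) :
    (redMat (((n : ↥(unitaryGroupOfForm (conjLocal L (IsCMField.complexConj L) v) (cmLocalForm L 3 v))) : GL (Fin 3) (LocalRing L v)).val.map (Pi.evalRingHom (fun w' : PlacesOver L v => w'.1.adicCompletion L) w)) - 1).rank = 0 ∨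
      (redMat (((n : ↥(unitaryGroupOfForm (conjLocal L (IsCMField.complexConj L) v) (cmLocalForm L 3 v))) : GL (Fin 3) (LocalRing L v)).val.map (Pi.evalRingHom (fun w' : PlacesOver L v => w'.1.adicCompletion L) w)) - 1).rank = 1 ∨
      (redMat (((n : ↥(unitaryGroupOfForm (conjLocal L (IsCMField.complexConj L) v) (cmLocalForm L 3 v))) : GL (Fin 3) (LocalRing L v)).val.map (Pi.evalRingHom (fun w' : PlacesOver L v => w'.1.adicCompletion L) w)) - 1).rank = 2 := by
  letI : Invertible (2 : LocalRing L v) := (isUnit_two_localRing L v).invertible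
  have hn' := HeisRing.heisElt_heisX_heisY (conjLocal L (IsCMField.complexConj L) v) (conjLocal_conjLocal_cm L v) (cmLocalForm_eq_over L 3 v) n
  have hmem := hn
  rw [← hn'] at hmem
  obtain ⟨hx, hy⟩ := (heisElt_mem_cmLocalIntegralLevel_iff L v w hw h2w _ _).1 hmem
  rw [← hn']
  rcases hx.lt_or_eq with hx' | hx'
  · rcases hy.lt_or_eq with hy' | hy'
    · exact Or.inl (rank_redMat_map_heisElt_sub_one_eq_zero L v w hw h2w hx' hy')
    · exact Or.inr (Or.inl (rank_redMat_map_heisElt_sub_one_eq_one L v w hw h2w hx' hy'))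
  · exact Or.inr (Or.inr (rank_redMat_map_heisElt_sub_one_eq_two L v w hw hx' _))

/-! ## §2 The integral of a rank-piece -/

set_option maxHeartbeats 800000 in
open scoped Classical in
include hw in
/-- **`∫_N F dμ_N = μ_N(N ∩ K₃) · q⁻³ · (c₀·1 + c₁·(q − 1) + c₂·(q³ − q))`** for every Haar measure `μ_N` of `N` and every `F : N → ℂ` with `F(n) = c(rank(red(n_w) − 1))`
on `N ∩ K₃` and `F(n) = 0` off `N ∩ K₃` (a depth-zero piece read on `N`): `F = Σ_r c_r·1_{S_r}` (§1 trichotomy), each `S_r` Borel of finite measure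
(§1), and ★ FILE B gives the three volumes. [cite: Rogawski1990, §4.9 p. 54] [cite: Flicker1998UnitaryFL, §2] -/
theorem integral_eq_of_eq_piece_rank [MeasurableSpace ↥(unipotentU (conjLocal L (IsCMField.complexConj L) v) (cmLocalForm L 3 v))] [BorelSpace ↥(unipotentU (conjLocal L (IsCMField.complexConj L) v) (cmLocalForm L 3 v))] (μN : Measure ↥(unipotentU (conjLocal L (IsCMField.complexConj L) v) (cmLocalForm L 3 v))) [μN.IsHaarMeasure]
    (hunr : Algebra.IsUnramifiedIn (𝓞 L) v.asIdeal) (h2w : Valued.v (2 : w.1.adicCompletion L) = 1) (c : ℕ → ℂ)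
    (F : ↥(unipotentU (conjLocal L (IsCMField.complexConj L) v) (cmLocalForm L 3 v)) → ℂ)
    (hF : ∀ n : ↥(unipotentU (conjLocal L (IsCMField.complexConj L) v) (cmLocalForm L 3 v)), F n = if (n : ↥(unitaryGroupOfForm (conjLocal L (IsCMField.complexConj L) v) (cmLocalForm L 3 v))) ∈ cmLocalIntegralLevel L 3 (Matrix.of fun i j : Fin 3 => if i.val + j.val + 1 = 3 then (1 : L) else 0) v then
      c (redMat (((n : ↥(unitaryGroupOfForm (conjLocal L (IsCMField.complexConj L) v) (cmLocalForm L 3 v))) : GL (Fin 3) (LocalRing L v)).val.map (Pi.evalRingHom (fun w' : PlacesOver L v => w'.1.adicCompletion L) w)) - 1).rank else 0) :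
    ∫ n, F n ∂μN =
      (μN.real {n : ↥(unipotentU (conjLocal L (IsCMField.complexConj L) v) (cmLocalForm L 3 v)) | (n : ↥(unitaryGroupOfForm (conjLocal L (IsCMField.complexConj L) v) (cmLocalForm L 3 v))) ∈ cmLocalIntegralLevel L 3 (Matrix.of fun i j : Fin 3 => if i.val + j.val + 1 = 3 then (1 : L) else 0) v} : ℂ) *
        (((Ideal.absNorm v.asIdeal : ℂ) ^ 3)⁻¹ * (c 0 * 1 + c 1 * ((Ideal.absNorm v.asIdeal : ℂ) - 1) + c 2 * ((Ideal.absNorm v.asIdeal : ℂ) ^ 3 - (Ideal.absNorm v.asIdeal : ℂ)))) := by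
  obtain ⟨hNO, hS2, hS1, hS0⟩ := measurableSet_level_and_rankStrata L v w hw h2w
  have hfin : μN {n : ↥(unipotentU (conjLocal L (IsCMField.complexConj L) v) (cmLocalForm L 3 v)) | (n : ↥(unitaryGroupOfForm (conjLocal L (IsCMField.complexConj L) v) (cmLocalForm L 3 v))) ∈ cmLocalIntegralLevel L 3 (Matrix.of fun i j : Fin 3 => if i.val + j.val + 1 = 3 then (1 : L) else 0) v} ≠ ∞ :=
    (isCompact_setOf_mem_level L v w hw h2w).measure_lt_top.ne
  have hfin' : ∀ r : ℕ, μN {n : ↥(unipotentU (conjLocal L (IsCMField.complexConj L) v) (cmLocalForm L 3 v)) | (n : ↥(unitaryGroupOfForm (conjLocal L (IsCMField.complexConj L) v) (cmLocalForm L 3 v))) ∈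
          cmLocalIntegralLevel L 3 (Matrix.of fun i j : Fin 3 => if i.val + j.val + 1 = 3 then (1 : L) else 0) v ∧
        (redMat (((n : ↥(unitaryGroupOfForm (conjLocal L (IsCMField.complexConj L) v) (cmLocalForm L 3 v))) : GL (Fin 3) (LocalRing L v)).val.map (Pi.evalRingHom (fun w' : PlacesOver L v => w'.1.adicCompletion L) w)) - 1).rank = r} ≠ ∞ :=
    fun r => ne_top_of_le_ne_top hfin (measure_mono fun n hn => hn.1)
  -- `F = Σ_r c_r · 1_{S_r}`
  have hFsum : F =
      Set.indicator {n : ↥(unipotentU (conjLocal L (IsCMField.complexConj L) v) (cmLocalForm L 3 v)) | (n : ↥(unitaryGroupOfForm (conjLocal L (IsCMField.complexConj L) v) (cmLocalForm L 3 v))) ∈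
          cmLocalIntegralLevel L 3 (Matrix.of fun i j : Fin 3 => if i.val + j.val + 1 = 3 then (1 : L) else 0) v ∧
        (redMat (((n : ↥(unitaryGroupOfForm (conjLocal L (IsCMField.complexConj L) v) (cmLocalForm L 3 v))) : GL (Fin 3) (LocalRing L v)).val.map (Pi.evalRingHom (fun w' : PlacesOver L v => w'.1.adicCompletion L) w)) - 1).rank = 0} (fun _ => c 0) +
      Set.indicator {n : ↥(unipotentU (conjLocal L (IsCMField.complexConj L) v) (cmLocalForm L 3 v)) | (n : ↥(unitaryGroupOfForm (conjLocal L (IsCMField.complexConj L) v) (cmLocalForm L 3 v))) ∈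
          cmLocalIntegralLevel L 3 (Matrix.of fun i j : Fin 3 => if i.val + j.val + 1 = 3 then (1 : L) else 0) v ∧
        (redMat (((n : ↥(unitaryGroupOfForm (conjLocal L (IsCMField.complexConj L) v) (cmLocalForm L 3 v))) : GL (Fin 3) (LocalRing L v)).val.map (Pi.evalRingHom (fun w' : PlacesOver L v => w'.1.adicCompletion L) w)) - 1).rank = 1} (fun _ => c 1) +
      Set.indicator {n : ↥(unipotentU (conjLocal L (IsCMField.complexConj L) v) (cmLocalForm L 3 v)) | (n : ↥(unitaryGroupOfForm (conjLocal L (IsCMField.complexConj L) v) (cmLocalForm L 3 v))) ∈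
          cmLocalIntegralLevel L 3 (Matrix.of fun i j : Fin 3 => if i.val + j.val + 1 = 3 then (1 : L) else 0) v ∧
        (redMat (((n : ↥(unitaryGroupOfForm (conjLocal L (IsCMField.complexConj L) v) (cmLocalForm L 3 v))) : GL (Fin 3) (LocalRing L v)).val.map (Pi.evalRingHom (fun w' : PlacesOver L v => w'.1.adicCompletion L) w)) - 1).rank = 2} (fun _ => c 2) := by
    funext n
    rw [Pi.add_apply, Pi.add_apply, hF n]
    by_cases hn : (n : ↥(unitaryGroupOfForm (conjLocal L (IsCMField.complexConj L) v) (cmLocalForm L 3 v))) ∈ cmLocalIntegralLevel L 3 (Matrix.of fun i j : Fin 3 => if i.val + j.val + 1 = 3 then (1 : L) else 0) v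
    · rw [if_pos hn]
      rcases rank_redMat_sub_one_cases_of_mem L v w hw h2w hn with h | h | h <;>
        simp [Set.indicator, hn, h]
    · simp [Set.indicator, hn]
  have hI : ∀ r : ℕ, MeasurableSet {n : ↥(unipotentU (conjLocal L (IsCMField.complexConj L) v) (cmLocalForm L 3 v)) | (n : ↥(unitaryGroupOfForm (conjLocal L (IsCMField.complexConj L) v) (cmLocalForm L 3 v))) ∈
          cmLocalIntegralLevel L 3 (Matrix.of fun i j : Fin 3 => if i.val + j.val + 1 = 3 then (1 : L) else 0) v ∧
        (redMat (((n : ↥(unitaryGroupOfForm (conjLocal L (IsCMField.complexConj L) v) (cmLocalForm L 3 v))) : GL (Fin 3) (LocalRing L v)).val.map (Pi.evalRingHom (fun w' : PlacesOver L v => w'.1.adicCompletion L) w)) - 1).rank = r} →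
      Integrable (Set.indicator {n : ↥(unipotentU (conjLocal L (IsCMField.complexConj L) v) (cmLocalForm L 3 v)) | (n : ↥(unitaryGroupOfForm (conjLocal L (IsCMField.complexConj L) v) (cmLocalForm L 3 v))) ∈
          cmLocalIntegralLevel L 3 (Matrix.of fun i j : Fin 3 => if i.val + j.val + 1 = 3 then (1 : L) else 0) v ∧
        (redMat (((n : ↥(unitaryGroupOfForm (conjLocal L (IsCMField.complexConj L) v) (cmLocalForm L 3 v))) : GL (Fin 3) (LocalRing L v)).val.map (Pi.evalRingHom (fun w' : PlacesOver L v => w'.1.adicCompletion L) w)) - 1).rank = r} (fun _ => c r)) μN :=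
    fun r hr => (integrable_indicator_iff hr).2 (integrableOn_const (hfin' r))
  rw [hFsum, integral_add' ((hI 0 hS0).add (hI 1 hS1)) (hI 2 hS2), integral_add' (hI 0 hS0) (hI 1 hS1),
    integral_indicator_const _ hS0, integral_indicator_const _ hS1, integral_indicator_const _ hS2,
    Complex.real_smul, Complex.real_smul, Complex.real_smul,
    measureReal_rankStratum_zero L v w hw μN hunr h2w, measureReal_rankStratum_one L v w hw μN hunr h2w,
    measureReal_rankStratum_two L v w hw μN hunr h2w]
  push_cast
  ring

end Literature.NumberTheory.Automorphic.UnitaryGroup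

end
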